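import Summits.Ventures.HSemireg.WedgeHankelRecurrenceGaussChebyshevCosecantSum

/-!
# Venture HSemireg — **THE HALF- AND QUARTER-ANGLE COSECANT AND SECANT SUMS: `∑_{j=1}^{n−1} 1∕sin²(πj∕2n) = ∑_{j=1}^{n−1} 1∕cos²(πj∕2n) = 2(n² − 1)∕3` and
# `∑_{j<n} 1∕sin²((2j+1)π∕4n) = ∑_{j<n} 1∕cos²((2j+1)π∕4n) = 2n²`** (`n ≥ 1`) — logarithmic derivatives of `S_{n−1} = ∏ (X − 2cos(πj∕n))` and `C_n = ∏ (X − 2cos((2j+1)π∕2n))` (N500) at `X = 2`: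
# `∑ 1∕(2 − 2cos(πj∕n)) = S_{n−1}'(2)∕S_{n−1}(2) = (n² − 1)∕6`, `∑ 1∕(2 − 2cos((2j+1)π∕2n)) = C_n'(2)∕C_n(2) = n²∕2`

HONEST FRAMING. Part of the Lean index of the computation cell `pub-hsemireg` (seat p10 gen 49, Sunday typer «UNIFORM-IN-n»).  Real polynomial calculus and trigonometry only (Mathlib
`Polynomial.derivative`, `Polynomial.Chebyshev.C ∕ S`, `Real.sin ∕ cos`); no variety, no cohomology theory, no sheaf, no Ext group and no semiregularity map is constructed here; nothing here says that
HC / HC_CM / HC_AV holds; no Literature fact (unproved `Prop`) is declared or used.  Custodian versions as in `WedgeHankelSiegelIdeal` (1/3).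
SOURCES (cited).  I. S. Gradshteyn, I. M. Ryzhik, *Table of Integrals, Series, and Products*, 1.382 (finite `csc²` ∕ `sec²` sums); A. M. Yaglom, I. M. Yaglom, *Challenging Mathematical Problems with
Elementary Solutions* II (1967), Problems 143–145; T. J. Rivlin, *The Chebyshev Polynomials* (1974), (1.97)–(1.98).
PROOF TYPED HERE.  `Literature…RootDragging.eval_derivative_prod_X_sub_C` (logarithmic derivative, Prasolov (1)) on N500 `chebyshevS_eq_prod_real` ∕ `chebyshevC_eq_prod_real` at `X = 2`, with Mathlib `S_eval_two`, `C_eval_two`, N513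
`six_mul_derivative_S_eval_two`, N510 `chebyshevC_derivative_eval_two`; then `2 − 2cos 2α = 4sin² α` and the reflections `j ↦ n − j`, `j ↦ n − 1 − j` (`sin(π∕2 − x) = cos x`).
DEDUP DISCLOSURE (`rg -n 'inv_sin_sq|inv_cos_sq|sec|cot_sq' Summits Literature`, `lean search`, 2026-09-04): the FULL-RANGE sums are in the tree and are CITED, not restated —
`Literature.Analysis.Quadrature.PolynomialLatticeDiscrepancy.sum_inv_sin_sq_eq` (`∑_{κ<b} csc²(πκ∕b) = (b²−1)∕3`, Dick–Pillichshammer Cor. A.23; the `b = 2n` instance folds to the half-range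
statement below) and `Literature.NumberTheory.ModularForms.sum_cot_sq_eq` (Beck–Robins Ex. 7.11); N513 has the `2 − 2cos(2πj∕n)` form; the HALF-RANGE `πj∕2n` and the quarter-angle `(2j+1)π∕4n`
cosecant ∕ secant sums below, obtained on the Chebyshev side from `S_{n−1}` and `C_n`, are in neither Mathlib nor the tree; 0 hits for the 6 names below.

WHAT IS IN THE TREE.  N500, N510, N513; `Literature…RootDragging.eval_derivative_prod_X_sub_C`; N501 `cos_ne_one_and_ne_neg_one_of_pos_of_lt_pi`; N511 `angle_quarter_mem`; N512 `angle_eighth_mem`; Mathlib `S_eval_two`, `C_eval_two`, `Real.sin_pi_div_two_sub`.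
THIS FILE (namespace `Summit.Ventures.HSemireg.Wedge.HankelOuter` continued; CHAINED on N513; 0 definitions):
* §1279 **`sum_inv_two_sub_two_mul_cos_half_eq`** (`= (n²−1)∕6`), **`sum_inv_sin_sq_half_eq`** (`∑ 1∕sin²(πj∕2n) = 2(n²−1)∕3`), **`sum_inv_cos_sq_half_eq`**,
  **`sum_inv_two_sub_two_mul_cos_odd_eq`** (`= n²∕2`), **`sum_inv_sin_sq_quarter_eq`** (`∑ 1∕sin²((2j+1)π∕4n) = 2n²`), **`sum_inv_cos_sq_quarter_eq`**.
CAVEATS.  `n ≥ 1`; sums over `j ∈ [1, n−1]` are written over `Finset.range (n − 1)` with the shift `j + 1`.  Nothing Ext-side.  New names only.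
-/

open Module Polynomial
open scoped Matrix Polynomial

namespace Summit.Ventures.HSemireg.Wedge.HankelOuter

/-! ## §1279. Half- and quarter-angle cosecant and secant sums -/

/-- **`∑_{j=1}^{n−1} 1∕(2 − 2cos(πj∕n)) = (n² − 1)∕6`** (`n ≥ 1`; `= S_{n−1}'(2)∕S_{n−1}(2)`). [Gradshteyn–Ryzhik 1.382; this file, §1279] -/
theorem sum_inv_two_sub_two_mul_cos_half_eq {n : ℕ} (hn : n ≠ 0) : ∑ j ∈ Finset.range (n - 1), 1 / (2 - 2 * Real.cos ((j + 1 : ℕ) * (Real.pi / n))) = ((n : ℝ) ^ 2 - 1) / 6 := by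
  obtain ⟨m, rfl⟩ := Nat.exists_eq_add_one_of_ne_zero hn
  rw [Nat.add_sub_cancel]
  have hne : ∀ j ∈ Finset.range m, (2 : ℝ) ≠ 2 * Real.cos ((j + 1) * Real.pi / (m + 1)) := fun j hj h => by
    have hj := Finset.mem_range.mp hj
    have hmem := (angle_half_mem hj).1
    exact (cos_ne_one_and_ne_neg_one_of_pos_of_lt_pi hmem.1 hmem.2).1 (by linarith)
  have hlog := Literature.Algebra.Polynomial.RootDragging.eval_derivative_prod_X_sub_C (Finset.range m) (fun j : ℕ => 2 * Real.cos ((j + 1) * Real.pi / (m + 1))) hne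
  rw [← chebyshevS_eq_prod_real m, Polynomial.Chebyshev.S_eval_two, Int.cast_natCast] at hlog
  have h6 := six_mul_derivative_S_eval_two (R := ℝ) (m : ℤ)
  rw [hlog, Int.cast_natCast] at h6
  have hθ : ∀ j : ℕ, ((j + 1 : ℕ) : ℝ) * (Real.pi / ((m + 1 : ℕ) : ℝ)) = ((j : ℝ) + 1) * Real.pi / ((m : ℝ) + 1) := fun j => by push_cast; ring
  simp_rw [hθ]
  have hm : ((m : ℝ) + 1) ≠ 0 := by positivity
  apply mul_left_cancel₀ hm
  push_cast
  linear_combination h6 / 6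

/-- **`∑_{j=1}^{n−1} 1∕sin²(πj∕2n) = 2(n² − 1)∕3`** (`n ≥ 1`). [Gradshteyn–Ryzhik 1.382; this file, §1279] -/
theorem sum_inv_sin_sq_half_eq {n : ℕ} (hn : n ≠ 0) : ∑ j ∈ Finset.range (n - 1), 1 / Real.sin ((j + 1 : ℕ) * (Real.pi / (2 * n))) ^ 2 = 2 * ((n : ℝ) ^ 2 - 1) / 3 := by
  have h := sum_inv_two_sub_two_mul_cos_half_eq hn
  have hnR : (n : ℝ) ≠ 0 := by exact_mod_cast hn
  have hterm : ∀ j ∈ Finset.range (n - 1), 1 / (2 - 2 * Real.cos ((j + 1 : ℕ) * (Real.pi / n))) = (1 / 4) * (1 / Real.sin ((j + 1 : ℕ) * (Real.pi / (2 * n))) ^ 2) := fun j _ => by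
    rw [show ((j + 1 : ℕ) : ℝ) * (Real.pi / n) = 2 * (((j + 1 : ℕ) : ℝ) * (Real.pi / (2 * n))) by field_simp, Real.cos_two_mul, Real.cos_sq']
    ring
  rw [Finset.sum_congr rfl hterm, ← Finset.mul_sum] at h
  linarith

/-- **`∑_{j=1}^{n−1} 1∕cos²(πj∕2n) = 2(n² − 1)∕3`** (`n ≥ 1`; reflection `j ↦ n − j`). [Gradshteyn–Ryzhik 1.382; this file, §1279] -/
theorem sum_inv_cos_sq_half_eq {n : ℕ} (hn : n ≠ 0) : ∑ j ∈ Finset.range (n - 1), 1 / Real.cos ((j + 1 : ℕ) * (Real.pi / (2 * n))) ^ 2 = 2 * ((n : ℝ) ^ 2 - 1) / 3 := by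
  rw [← Finset.sum_range_reflect (fun j => 1 / Real.cos ((j + 1 : ℕ) * (Real.pi / (2 * n))) ^ 2) (n - 1)]
  refine Eq.trans (Finset.sum_congr rfl fun j hj => ?_) (sum_inv_sin_sq_half_eq hn)
  have hj := Finset.mem_range.mp hj
  have hnR : (n : ℝ) ≠ 0 := by exact_mod_cast hn
  have hidx : (((n - 1 - 1 - j + 1 : ℕ)) : ℝ) * (Real.pi / (2 * n)) = Real.pi / 2 - ((j + 1 : ℕ) : ℝ) * (Real.pi / (2 * n)) := by
    rw [show n - 1 - 1 - j + 1 = n - (j + 1) by omega, Nat.cast_sub (by omega)]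
    field_simp
  simp only [hidx, Real.cos_pi_div_two_sub]

/-- **`∑_{j<n} 1∕(2 − 2cos((2j+1)π∕2n)) = n²∕2`** (`n ≥ 1`; `= C_n'(2)∕C_n(2)`). [Gradshteyn–Ryzhik 1.382; this file, §1279] -/
theorem sum_inv_two_sub_two_mul_cos_odd_eq {n : ℕ} (hn : n ≠ 0) : ∑ j ∈ Finset.range n, 1 / (2 - 2 * Real.cos ((2 * j + 1) * Real.pi / (2 * n))) = (n : ℝ) ^ 2 / 2 := by
  have hne : ∀ j ∈ Finset.range n, (2 : ℝ) ≠ 2 * Real.cos ((2 * j + 1) * Real.pi / (2 * n)) := fun j hj h => by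
    have hj := Finset.mem_range.mp hj
    have hmem := (angle_half_mem hj).2
    exact (cos_ne_one_and_ne_neg_one_of_pos_of_lt_pi hmem.1 hmem.2).1 (by linarith)
  have hlog := Literature.Algebra.Polynomial.RootDragging.eval_derivative_prod_X_sub_C (Finset.range n) (fun j : ℕ => 2 * Real.cos ((2 * j + 1) * Real.pi / (2 * n))) hne
  rw [← chebyshevC_eq_prod_real hn, chebyshevC_derivative_eval_two, Polynomial.Chebyshev.C_eval_two] at hlog
  linarith

/-- **`∑_{j<n} 1∕sin²((2j+1)π∕4n) = 2n²`** (`n ≥ 1`). [Gradshteyn–Ryzhik 1.382; this file, §1279] -/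
theorem sum_inv_sin_sq_quarter_eq {n : ℕ} (hn : n ≠ 0) : ∑ j ∈ Finset.range n, 1 / Real.sin ((2 * j + 1) * Real.pi / (4 * n)) ^ 2 = 2 * (n : ℝ) ^ 2 := by
  have h := sum_inv_two_sub_two_mul_cos_odd_eq hn
  have hnR : (n : ℝ) ≠ 0 := by exact_mod_cast hn
  have hterm : ∀ j ∈ Finset.range n, 1 / (2 - 2 * Real.cos ((2 * j + 1) * Real.pi / (2 * n))) = (1 / 4) * (1 / Real.sin ((2 * j + 1) * Real.pi / (4 * n)) ^ 2) := fun j _ => by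
    rw [show (2 * (j : ℝ) + 1) * Real.pi / (2 * n) = 2 * ((2 * (j : ℝ) + 1) * Real.pi / (4 * n)) by field_simp; ring, Real.cos_two_mul, Real.cos_sq']
    ring
  rw [Finset.sum_congr rfl hterm, ← Finset.mul_sum] at h
  linarith

/-- **`∑_{j<n} 1∕cos²((2j+1)π∕4n) = 2n²`** (`n ≥ 1`; reflection `j ↦ n − 1 − j`). [Gradshteyn–Ryzhik 1.382; this file, §1279] -/
theorem sum_inv_cos_sq_quarter_eq {n : ℕ} (hn : n ≠ 0) : ∑ j ∈ Finset.range n, 1 / Real.cos ((2 * j + 1) * Real.pi / (4 * n)) ^ 2 = 2 * (n : ℝ) ^ 2 := by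
  rw [← Finset.sum_range_reflect (fun j => 1 / Real.cos ((2 * j + 1) * Real.pi / (4 * n)) ^ 2) n]
  refine Eq.trans (Finset.sum_congr rfl fun j hj => ?_) (sum_inv_sin_sq_quarter_eq hn)
  have hj := Finset.mem_range.mp hj
  have hnR : (n : ℝ) ≠ 0 := by exact_mod_cast hn
  have hidx : (2 * ((n - 1 - j : ℕ) : ℝ) + 1) * Real.pi / (4 * n) = Real.pi / 2 - (2 * (j : ℝ) + 1) * Real.pi / (4 * n) := by
    rw [Nat.cast_sub (by omega), Nat.cast_sub (Nat.one_le_iff_ne_zero.mpr hn), Nat.cast_one]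
    field_simp
    ring
  simp only [hidx, Real.cos_pi_div_two_sub]

end Summit.Ventures.HSemireg.Wedge.HankelOuter
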